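import Summits.AnomalousDissipation.AnomalousDissipation.Theorems.SawtoothPulseCascadeK1LocalisedCascadeCanonicalStripStepsCTE
import Summits.AnomalousDissipation.AnomalousDissipation.Theorems.SawtoothPulseCascadeK1LocalisedCascadeGeomRatioStepsCTE

/-!
# K1loc — helper: THE STRIP AND LOW-FIBRE STEPS ON GEOMETRIC BLOCKS OF ARBITRARY RATIO, CORNER-TRACE GRADE, AGGREGATE TRACKED
ENERGY

Helper file of the prover lane on the crux `K1LocalisedCascade` (stmt-AnomalousDissipation-19491), route `SawtoothPulseCascade`
(S-D seat, arbiter A24-4: the phase-3 CT ledger; finding F-p1g8-1 §2).  `…StripBlocksCTE.tsum_strip_vstep_blocks_ctE_le` /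
`tsum_lowFibre_hstep_blocks_ctE_le` with every per-block scalar discharged on the family `Λ_m = ⌊Λ₀(r_a)^m/(r_b)^m⌋` of
`…GeomBlocks` (`ρ = r_a/r_b > 1`), thin cut-offs `Q₂^m = ⌊q_nΛ_m/q_d⌋`, `Q₁^m = ⌊u′Λ_{m+1}/v′⌋`, closed forms of `…BlockJunkCTEGeom`:
  `strip ≤ exact + ((√(A + β*/2) + √(ρ*/2 + Z) + √feed)² + tail²)`,
  `A = 6N²r*(ρ²/((ρ²−1)S₀²) + ρ/((ρ−1)NS₀))/π²`, `β* = 12N²ϑ²(2q₀/(NS₀²) + 2q₀/(N²S₀) + 1/S₀² + 1/(NS₀))/π²`,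
  `ρ* = (πΛ₀Gρ^{M_b}ε/N)²`, `Z = M_b·(8Mδ_j·r*/π)`, `r* = (c_d + c_n)/(c_d − c_n)`,
`S₀ = G(Λ₀−1) − K`, `q₀ = q_nΛ₀/q_d`, `ϑ = q_nΛ₀/((Gq_d − q_n)(Λ₀−1) − Kq_d)` (`N = N_j`).
* `strip_vstep_geomCTE_le` (S-V), `lowFibre_hstep_geomCTE_le` (T-H).
No definitions; no statement about the crux. [cite: Grafakos2014, Prop. 3.1.2 (5), Prop. 3.2.7 (3), §3.1.3] [problem: turb]
-/

-- `Summit.<Summit>.<Problem>`: single-conjunct summit, the duplicate namespace segment is deliberate.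
set_option linter.dupNamespace false

noncomputable section

namespace Summit.AnomalousDissipation.AnomalousDissipation.Theorems.SawtoothPulseCascade.K1Window

open MeasureTheory Set Filter Topology UnitAddTorus Function Complex Metric
open scoped Real ENNReal
open Literature.Analysis Literature.Analysis.FunctionSpaces Literature.Analysis.FunctionSpaces.Torus Literature.Analysis.FluidPDE
open Literature.Analysis.FluidPDE.ShearStage
open Literature.Analysis.FluidPDE.SawtoothCascade Literature.Analysis.FluidPDE.SawtoothCascade.CascadeParams
open Summit.AnomalousDissipation.AnomalousDissipation.Theorems.SawtoothPulseCascade.K1Start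
open Summit.AnomalousDissipation.AnomalousDissipation.Theorems.SawtoothPulseCascade.K1Flat
open Summit.AnomalousDissipation.AnomalousDissipation.Theorems.SawtoothPulseCascade.K1Ledger.From

section Cascade

variable (P : CascadeParams)

/-! ## §1 The steps -/

/-- **(S-V) ON GEOMETRIC BLOCKS OF RATIO `a/b`, CT GRADE, AGGREGATE TRACKED ENERGY.**  The strip `Σ'[|k₀| < K]‖𝓕a_{j+1}‖²`:
the low fibres `|k₁| < Λ₀` pass exactly, the chopped fibres are cut into blocks `Λ_m = ⌊Λ₀(r_a)^m/(r_b)^m⌋` from the floor `Λ₀ ≥ 2`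
(`Kq_d + q_n(Λ₀−1) < Gq_d(Λ₀−1)`), lobe `Q₂^m = ⌊q_nΛ_m/q_d⌋`, plateau `Q₁^m = ⌊u′Λ_{m+1}/v′⌋`, separation and cut-off fraction
`c_n/c_d` from slope + base at `Λ₀`, `M_b` blocks, zone parameter `M ≥ 1` with `Mδ_j < π/2`, rounding `ε ≥ e^{−M²/2}`.  Then
`strip ≤ Σ'[|k₁| < Λ₀]‖𝓕b_j‖² + ((√(A + β*/2) + √(ρ*/2 + Z) + √(Σ'[Y ≤ |k₀| ∧ u′|k₁| ≤ v′|k₀|]‖𝓕b_j‖²))² + ((1+γ)^{2(j+1)}/Λ_{M_b})²)`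
with `S₀ = G(Λ₀−1) − K`, `q₀ = q_nΛ₀/q_d`, `ϑ = q_nΛ₀/((Gq_d − q_n)(Λ₀−1) − Kq_d)`, `r* = (c_d+c_n)/(c_d−c_n)`.
[cite: Grafakos2014, Prop. 3.1.2 (5), Prop. 3.2.7 (3), §3.1.3] -/
theorem strip_vstep_geomCTE_le {G : ℕ} (hγ : P.γ = G) (hδ₀ : 0 < P.δ₀) (hd : 0 < P.d) (hN₀ : 1 ≤ P.N₀)
    (hρN : 1 ≤ P.ρN) (a b : ℕ → UnitAddTorus (Fin 2) → ℝ) (has : ∀ j, IsSmooth (a j)) (h0 : a 0 = datum)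
    (hb : ∀ j, b j = a j ∘ shearMap 0 1 (amp ⟨P.U j, P.U_periodic j, P.contDiff_U (P.δ_pos hδ₀ hd j)⟩ P.γ))
    (hab : ∀ j, a (j + 1) = b j ∘ shearMap 1 0 (amp ⟨P.U j, P.U_periodic j, P.contDiff_U (P.δ_pos hδ₀ hd j)⟩ P.γ))
    (j : ℕ) {K u' v' Y qn qd cn cd ra rb Λ0 : ℕ} (hqd : 0 < qd)
    (hK : K * qd + qn * (Λ0 - 1) < G * qd * (Λ0 - 1)) (hrb : 0 < rb) (hrab : rb < ra) (hΛ0 : 2 ≤ Λ0)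
    (hv' : 0 < v') (hslope : ra * qd * u' ≤ rb * v' * qn)
    (hbase : qd * (u' * (ra - 1) + rb * v') + ra * qd * u' * Λ0 ≤ rb * v' * qn * Λ0)
    (hcd : cn < cd) (hslope' : ra * qd * cd * u' ≤ rb * cn * v' * qn)
    (hbase' : qd * cd * u' * (ra * Λ0 + (ra - 1)) + rb * cn * v' * qd ≤ rb * cn * v' * qn * Λ0)
    (hY : Y ≤ u' * Λ0 / v' + 1) (Mb : ℕ) {M ε : ℝ} (hM : 1 ≤ M) (hMδ : M * P.δ j < π / 2)
    (hε : Real.exp (-(M ^ 2 / 2)) ≤ ε) :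
    ∑' k : Fin 2 → ℤ, (if |k 0| < (K : ℤ) then (1 : ℝ) else 0) * ‖mFourierCoeff (fun x => (a (j + 1) x : ℂ)) k‖ ^ 2 ≤
      ∑' k : Fin 2 → ℤ, (if |k 1| < (Λ0 : ℤ) then (1 : ℝ) else 0) * ‖mFourierCoeff (fun x => (b j x : ℂ)) k‖ ^ 2 +
      ((Real.sqrt (6 * (P.N j : ℝ) ^ 2 * (((cd : ℝ) + cn) / ((cd : ℝ) - cn)) *
              (((ra : ℝ) / rb) ^ 2 / ((((ra : ℝ) / rb) ^ 2 - 1) * ((G : ℝ) * ((Λ0 : ℝ) - 1) - K) ^ 2) +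
                ((ra : ℝ) / rb) / ((((ra : ℝ) / rb) - 1) * (P.N j * ((G : ℝ) * ((Λ0 : ℝ) - 1) - K)))) / π ^ 2 +
            12 * (P.N j : ℝ) ^ 2 * ((qn : ℝ) * Λ0 / ((((G : ℝ) * qd - qn) * ((Λ0 : ℝ) - 1) - K * qd))) ^ 2 *
              (2 * ((qn : ℝ) * Λ0 / qd) / (P.N j * ((G : ℝ) * ((Λ0 : ℝ) - 1) - K) ^ 2) + 2 * ((qn : ℝ) * Λ0 / qd) / ((P.N j : ℝ) ^ 2 * ((G : ℝ) * ((Λ0 : ℝ) - 1) - K)) +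
                1 / ((G : ℝ) * ((Λ0 : ℝ) - 1) - K) ^ 2 + 1 / (P.N j * ((G : ℝ) * ((Λ0 : ℝ) - 1) - K))) / π ^ 2 / 2) +
          Real.sqrt ((π * ((Λ0 : ℝ) * G) * ((ra : ℝ) / rb) ^ Mb * ε / P.N j) ^ 2 / 2 +
            Mb * (8 * M * P.δ j / π * (((cd : ℝ) + cn) / ((cd : ℝ) - cn)))) +
          Real.sqrt (∑' k : Fin 2 → ℤ, (if (Y : ℤ) ≤ |k 0| ∧ (u' : ℤ) * |k 1| ≤ (v' : ℤ) * |k 0| then (1 : ℝ) else 0) *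
            ‖mFourierCoeff (fun x => (b j x : ℂ)) k‖ ^ 2)) ^ 2 +
        ((1 + P.γ) ^ (2 * (j + 1)) / ((Λ0 * ra ^ Mb / rb ^ Mb : ℕ) : ℝ)) ^ 2) := by
  -- the block family and its cut-offs
  have hN : (0 : ℝ) < P.N j := by exact_mod_cast P.N_pos hN₀ hρN j
  have hδ : 0 < P.δ j := P.δ_pos hδ₀ hd j
  have hε0 : 0 ≤ ε := (Real.exp_pos _).le.trans hε
  have hra1 : 1 ≤ ra := by omega
  set Λb : ℕ → ℕ := fun m => Λ0 * ra ^ m / rb ^ m with hΛb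
  set Q₂ : ℕ → ℕ := fun m => qn * Λb m / qd with hQ₂
  set Q₁ : ℕ → ℕ := fun m => u' * Λb (m + 1) / v' with hQ₁def
  set R : ℕ → ℕ := fun m => Q₂ m - Q₁ m with hRdef
  set ρ : ℝ := (ra : ℝ) / rb with hρdef
  have hrbr : (0 : ℝ) < rb := by exact_mod_cast hrb
  have hρ1 : 1 < ρ := by
    rw [hρdef, lt_div_iff₀ hrbr, one_mul]; exact_mod_cast hrab
  have hΛmono : Monotone Λb := geom_blocks_monotone hrb hrab.le Λ0
  have hΛge : ∀ m, Λ0 ≤ Λb m := fun m => geom_blocks_ge hrb hrab.le Λ0 m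
  have hΛ1 : ∀ m, 1 ≤ Λb m := fun m => le_trans (by omega) (hΛge m)
  have e0 : Λb 0 = Λ0 := geom_blocks_zero Λ0 ra rb
  have hΛb0 : 1 ≤ Λb 0 := hΛ1 0
  have hsucc : ∀ m, rb * Λb (m + 1) ≤ ra * Λb m + (ra - 1) := fun m => geom_blocks_succ_le hrb hra1 Λ0 m
  have hQ12 : ∀ m, Q₁ m < Q₂ m := fun m => geom_sep hrb hv' hqd (hsucc m) (hΛge m) hslope hbase
  have hfrac : ∀ m, cd * (u' * Λb (m + 1)) ≤ cn * (v' * Q₂ m) := fun m =>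
    geom_frac hrb hqd (hsucc m) (hΛge m) hslope' hbase'
  have eQR : ∀ m, Q₁ m + R m = Q₂ m := fun m => Nat.add_sub_cancel' (hQ12 m).le
  have hRpos : ∀ m, 0 < R m := fun m => Nat.sub_pos_of_lt (hQ12 m)
  have hfeed : ∀ m, u' * Λb (m + 1) ≤ v' * (Q₁ m + 1) := fun m => thin_feed u' hv' _
  have hcd0 : 0 < cd := lt_of_le_of_lt (Nat.zero_le _) hcd
  have hqdr : (0 : ℝ) < qd := by exact_mod_cast hqd
  have hΛ0r : (0 : ℝ) < (Λ0 : ℝ) - 1 := by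
    have : (2 : ℝ) ≤ Λ0 := by exact_mod_cast hΛ0
    linarith
  have hcdr : (0 : ℝ) < (cd : ℝ) - cn := by
    have : (cn : ℝ) < cd := by exact_mod_cast hcd
    linarith
  -- the trace ratio of every block
  have hT : ∀ m, (Real.sqrt ((2 * Q₁ m + R m : ℕ) * R m) / R m * 1) ^ 2 / 2 +
      (Real.sqrt ((2 * Q₁ m + R m : ℕ) * R m) / R m * 1) ^ 2 / 2 ≤ ((cd : ℝ) + cn) / ((cd : ℝ) - cn) := fun m => by
    rw [boxTrace_halves_eq (Q₁ m) (hRpos m)]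
    have e1 : 2 * Q₁ m + R m = Q₁ m + Q₂ m := by rw [two_mul, add_assoc, eQR]
    have e2 : ((R m : ℕ) : ℝ) = ((Q₂ m : ℕ) : ℝ) - ((Q₁ m : ℕ) : ℝ) := by
      rw [← eQR m, Nat.cast_add]; ring
    rw [e1, Nat.cast_add, e2]
    exact thin_r_le hv' hcd0 hcd (hQ12 m) (hfrac m)
  have hT0 : ∀ m, 0 ≤ (Real.sqrt ((2 * Q₁ m + R m : ℕ) * R m) / R m * 1) ^ 2 / 2 +
      (Real.sqrt ((2 * Q₁ m + R m : ℕ) * R m) / R m * 1) ^ 2 / 2 := fun m => by positivity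
  have hΛ'0 : ∀ m, (0 : ℝ) ≤ ((Λb (m + 1) * G : ℕ) : ℝ) := fun m => by positivity
  have hΛ' : ∀ m, ((Λb (m + 1) * G : ℕ) : ℝ) ≤ (Λ0 : ℝ) * G * ρ ^ (m + 1) := fun m => geom_top_le hrb G Λ0 m
  have hQ0' : ∀ m, (0 : ℝ) ≤ ((Q₁ m + R m : ℕ) : ℝ) := fun m => by positivity
  set q₀ : ℝ := (qn : ℝ) * Λ0 / qd with hq₀
  have hq₀0 : 0 ≤ q₀ := by positivity
  have hQle : ∀ m, ((Q₁ m + R m : ℕ) : ℝ) ≤ q₀ * ρ ^ m := fun m => by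
    rw [eQR]; exact geom_Q₂_le hrb qn qd Λ0 m
  -- the strip margin
  obtain ⟨L1, hL1⟩ : ∃ L1, Λ0 = L1 + 1 := ⟨Λ0 - 1, by omega⟩
  have hL1' : Λ0 - 1 = L1 := by omega
  have hqG : qn ≤ G * qd := by
    have h1 : qn * (Λ0 - 1) < G * qd * (Λ0 - 1) := lt_of_le_of_lt (Nat.le_add_left _ _) hK
    exact (Nat.lt_of_mul_lt_mul_right h1).le
  have hK0 : K * qd + qn * Λ0 < G * qd * Λ0 := by
    have h2 : qn * Λ0 = qn * (Λ0 - 1) + qn := by rw [hL1', hL1]; ring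
    have h3 : G * qd * Λ0 = G * qd * (Λ0 - 1) + G * qd := by rw [hL1', hL1]; ring
    rw [h2, h3]; omega
  have hKr : (K : ℝ) * qd + qn * ((Λ0 : ℝ) - 1) < G * qd * ((Λ0 : ℝ) - 1) := by
    have h1 : ((K * qd + qn * (Λ0 - 1) : ℕ) : ℝ) < ((G * qd * (Λ0 - 1) : ℕ) : ℝ) := by exact_mod_cast hK
    have e : ((Λ0 - 1 : ℕ) : ℝ) = (Λ0 : ℝ) - 1 := by rw [Nat.cast_sub (by omega)]; simp
    push_cast [e] at h1
    linarith
  have hc3 : (0 : ℝ) < ((G : ℝ) * qd - qn) * ((Λ0 : ℝ) - 1) - K * qd := by linarith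
  set S₀ : ℝ := (G : ℝ) * ((Λ0 : ℝ) - 1) - K with hS₀
  set D₀ : ℝ := (((G : ℝ) * qd - qn) * ((Λ0 : ℝ) - 1) - K * qd) / qd with hD₀
  have hS₀pos : 0 < S₀ := by
    have hqn0 : (0 : ℝ) ≤ (qn : ℝ) * ((Λ0 : ℝ) - 1) := by positivity
    have h1 : 0 < ((G : ℝ) * ((Λ0 : ℝ) - 1) - K) * qd := by nlinarith
    exact (mul_pos_iff_of_pos_right hqdr).mp h1
  have hD₀pos : 0 < D₀ := by positivity
  have hΛQ : ∀ m, K + (Q₁ m + R m) < Λb m * G := fun m => by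
    rw [eQR]; exact canon_strip_shift hK0 (hΛge m)
  have hDge : ∀ m, D₀ * ρ ^ m ≤ ((Λb m * G : ℕ) : ℝ) - ((K + (Q₁ m + R m) : ℕ) : ℝ) := fun m => by
    rw [eQR]; exact geom_strip_den_ge hrb hrab.le hqd hqG m
  have hS : ∀ m, S₀ * ρ ^ m ≤ ((Λb m * G : ℕ) : ℝ) - ((K + (Q₁ m + R m) : ℕ) : ℝ) + ((Q₁ m + R m : ℕ) : ℝ) := fun m => by
    rw [eQR]; exact geom_strip_span_ge hrb hrab.le m
  have eϑ : q₀ / D₀ = (qn : ℝ) * Λ0 / ((((G : ℝ) * qd - qn) * ((Λ0 : ℝ) - 1) - K * qd)) := by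
    rw [hq₀, hD₀]
    field_simp
  have hYm : ∀ m, Y ≤ Q₁ m + 1 := fun m => by
    have h1 : u' * Λ0 / v' ≤ Q₁ m := Nat.div_le_div_right (Nat.mul_le_mul_left _ (hΛge (m + 1)))
    omega
  -- the four scalar bounds in closed form
  have hA := ctTraceGeom_sum_le (D := fun m => ((Λb m * G : ℕ) : ℝ) - ((K + (Q₁ m + R m) : ℕ) : ℝ))
    (Q := fun m => ((Q₁ m + R m : ℕ) : ℝ)) (T := fun m => (Real.sqrt ((2 * Q₁ m + R m : ℕ) * R m) / R m * 1) ^ 2 / 2 +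
      (Real.sqrt ((2 * Q₁ m + R m : ℕ) * R m) / R m * 1) ^ 2 / 2) (N := (P.N j : ℝ)) (S₀ := S₀)
    (rs := ((cd : ℝ) + cn) / ((cd : ℝ) - cn)) hN hS₀pos hρ1 hS hT0 hT Mb
  have hβ := fun m (_ : m ∈ Finset.range Mb) => ctResidueGeom_le (D := ((Λb m * G : ℕ) : ℝ) - ((K + (Q₁ m + R m) : ℕ) : ℝ))
    (Q := ((Q₁ m + R m : ℕ) : ℝ)) (N := (P.N j : ℝ)) (D₀ := D₀) (S₀ := S₀) (q₀ := q₀) hN hD₀pos hS₀pos hq₀0 hρ1.le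
    (hDge m) (hS m) (hQ0' m) (hQle m)
  rw [eϑ] at hβ
  have hρ := fun m (hm : m ∈ Finset.range Mb) => ctRoundGeom_le (Λ' := ((Λb (m + 1) * G : ℕ) : ℝ)) (N := (P.N j : ℝ))
    (ℓ₀ := (Λ0 : ℝ) * G) (ε := ε) hN hε0 (by positivity) hρ1.le (hΛ'0 m) (hΛ' m) (Finset.mem_range.mp hm)
  have hZ := ctZone_sum_le (T := fun m => (Real.sqrt ((2 * Q₁ m + R m : ℕ) * R m) / R m * 1) ^ 2 / 2 +
      (Real.sqrt ((2 * Q₁ m + R m : ℕ) * R m) / R m * 1) ^ 2 / 2) (M := M) (δ := P.δ j) (rs := ((cd : ℝ) + cn) / ((cd : ℝ) - cn))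
    (by linarith) hδ.le hT Mb
  beta_reduce at hA hZ
  -- the multi-block step
  have hstep := tsum_strip_vstep_blocks_ctE_le P hγ hδ₀ hd hN₀ hρN a b has h0 hb hab j K Λb hΛmono hΛb0 Mb
    Q₁ R hRpos hΛQ hM hMδ hε (u' := u') (v' := v') (Y := Y) hfeed hYm (by positivity) (by positivity) hA hβ hρ hZ
  rw [e0] at hstep
  exact hstep

/-- **(T-H) ON GEOMETRIC BLOCKS OF RATIO `a/b`, CT GRADE, AGGREGATE TRACKED ENERGY.**  The low fibres `Σ'[|k₁| < K]‖𝓕b_j‖²`: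
the fibres `|k₀| < Λ₀` pass exactly, the chopped fibres `k₀` are cut into blocks `Λ_m = ⌊Λ₀(r_a)^m/(r_b)^m⌋` from the floor `Λ₀ ≥ 2`
(the strip threshold of `a_j`; `Kq_d + q_n(Λ₀−1) < Gq_d(Λ₀−1)`), feed = the off-cone class `Σ'[Λ₀ ≤ |k₀| ∧ u′|k₀| ≤ v′|k₁|]‖𝓕a_j‖²`,
geometry as in `strip_vstep_geomCTE_le`.  Then `T ≤ Σ'[|k₀| < Λ₀]‖𝓕a_j‖² + ((√(A + β*/2) + √(ρ*/2 + Z) + √feed)² + ((1+γ)^{2j}/Λ_{M_b})²)`.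
[cite: Grafakos2014, Prop. 3.1.2 (5), Prop. 3.2.7 (3), §3.1.3] -/
theorem lowFibre_hstep_geomCTE_le {G : ℕ} (hγ : P.γ = G) (hδ₀ : 0 < P.δ₀) (hd : 0 < P.d) (hN₀ : 1 ≤ P.N₀)
    (hρN : 1 ≤ P.ρN) (a b : ℕ → UnitAddTorus (Fin 2) → ℝ) (has : ∀ j, IsSmooth (a j)) (h0 : a 0 = datum)
    (hb : ∀ j, b j = a j ∘ shearMap 0 1 (amp ⟨P.U j, P.U_periodic j, P.contDiff_U (P.δ_pos hδ₀ hd j)⟩ P.γ))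
    (hab : ∀ j, a (j + 1) = b j ∘ shearMap 1 0 (amp ⟨P.U j, P.U_periodic j, P.contDiff_U (P.δ_pos hδ₀ hd j)⟩ P.γ))
    (j : ℕ) {K u' v' qn qd cn cd ra rb Λ0 : ℕ} (hqd : 0 < qd)
    (hK : K * qd + qn * (Λ0 - 1) < G * qd * (Λ0 - 1)) (hrb : 0 < rb) (hrab : rb < ra) (hΛ0 : 2 ≤ Λ0)
    (hv' : 0 < v') (hslope : ra * qd * u' ≤ rb * v' * qn)
    (hbase : qd * (u' * (ra - 1) + rb * v') + ra * qd * u' * Λ0 ≤ rb * v' * qn * Λ0)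
    (hcd : cn < cd) (hslope' : ra * qd * cd * u' ≤ rb * cn * v' * qn)
    (hbase' : qd * cd * u' * (ra * Λ0 + (ra - 1)) + rb * cn * v' * qd ≤ rb * cn * v' * qn * Λ0)
    (Mb : ℕ) {M ε : ℝ} (hM : 1 ≤ M) (hMδ : M * P.δ j < π / 2)
    (hε : Real.exp (-(M ^ 2 / 2)) ≤ ε) :
    ∑' k : Fin 2 → ℤ, (if |k 1| < (K : ℤ) then (1 : ℝ) else 0) * ‖mFourierCoeff (fun x => (b j x : ℂ)) k‖ ^ 2 ≤
      ∑' k : Fin 2 → ℤ, (if |k 0| < (Λ0 : ℤ) then (1 : ℝ) else 0) * ‖mFourierCoeff (fun x => (a j x : ℂ)) k‖ ^ 2 +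
      ((Real.sqrt (6 * (P.N j : ℝ) ^ 2 * (((cd : ℝ) + cn) / ((cd : ℝ) - cn)) *
              (((ra : ℝ) / rb) ^ 2 / ((((ra : ℝ) / rb) ^ 2 - 1) * ((G : ℝ) * ((Λ0 : ℝ) - 1) - K) ^ 2) +
                ((ra : ℝ) / rb) / ((((ra : ℝ) / rb) - 1) * (P.N j * ((G : ℝ) * ((Λ0 : ℝ) - 1) - K)))) / π ^ 2 +
            12 * (P.N j : ℝ) ^ 2 * ((qn : ℝ) * Λ0 / ((((G : ℝ) * qd - qn) * ((Λ0 : ℝ) - 1) - K * qd))) ^ 2 *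
              (2 * ((qn : ℝ) * Λ0 / qd) / (P.N j * ((G : ℝ) * ((Λ0 : ℝ) - 1) - K) ^ 2) + 2 * ((qn : ℝ) * Λ0 / qd) / ((P.N j : ℝ) ^ 2 * ((G : ℝ) * ((Λ0 : ℝ) - 1) - K)) +
                1 / ((G : ℝ) * ((Λ0 : ℝ) - 1) - K) ^ 2 + 1 / (P.N j * ((G : ℝ) * ((Λ0 : ℝ) - 1) - K))) / π ^ 2 / 2) +
          Real.sqrt ((π * ((Λ0 : ℝ) * G) * ((ra : ℝ) / rb) ^ Mb * ε / P.N j) ^ 2 / 2 +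
            Mb * (8 * M * P.δ j / π * (((cd : ℝ) + cn) / ((cd : ℝ) - cn)))) +
          Real.sqrt (∑' k : Fin 2 → ℤ, (if (Λ0 : ℤ) ≤ |k 0| ∧ (u' : ℤ) * |k 0| ≤ (v' : ℤ) * |k 1| then (1 : ℝ) else 0) *
            ‖mFourierCoeff (fun x => (a j x : ℂ)) k‖ ^ 2)) ^ 2 +
        ((1 + P.γ) ^ (2 * j) / ((Λ0 * ra ^ Mb / rb ^ Mb : ℕ) : ℝ)) ^ 2) := by
  -- the block family and its cut-offs
  have hN : (0 : ℝ) < P.N j := by exact_mod_cast P.N_pos hN₀ hρN j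
  have hδ : 0 < P.δ j := P.δ_pos hδ₀ hd j
  have hε0 : 0 ≤ ε := (Real.exp_pos _).le.trans hε
  have hra1 : 1 ≤ ra := by omega
  set Λb : ℕ → ℕ := fun m => Λ0 * ra ^ m / rb ^ m with hΛb
  set Q₂ : ℕ → ℕ := fun m => qn * Λb m / qd with hQ₂
  set Q₁ : ℕ → ℕ := fun m => u' * Λb (m + 1) / v' with hQ₁def
  set R : ℕ → ℕ := fun m => Q₂ m - Q₁ m with hRdef
  set ρ : ℝ := (ra : ℝ) / rb with hρdef
  have hrbr : (0 : ℝ) < rb := by exact_mod_cast hrb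
  have hρ1 : 1 < ρ := by
    rw [hρdef, lt_div_iff₀ hrbr, one_mul]; exact_mod_cast hrab
  have hΛmono : Monotone Λb := geom_blocks_monotone hrb hrab.le Λ0
  have hΛge : ∀ m, Λ0 ≤ Λb m := fun m => geom_blocks_ge hrb hrab.le Λ0 m
  have hΛ1 : ∀ m, 1 ≤ Λb m := fun m => le_trans (by omega) (hΛge m)
  have e0 : Λb 0 = Λ0 := geom_blocks_zero Λ0 ra rb
  have hΛb0 : 1 ≤ Λb 0 := hΛ1 0
  have hsucc : ∀ m, rb * Λb (m + 1) ≤ ra * Λb m + (ra - 1) := fun m => geom_blocks_succ_le hrb hra1 Λ0 m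
  have hQ12 : ∀ m, Q₁ m < Q₂ m := fun m => geom_sep hrb hv' hqd (hsucc m) (hΛge m) hslope hbase
  have hfrac : ∀ m, cd * (u' * Λb (m + 1)) ≤ cn * (v' * Q₂ m) := fun m =>
    geom_frac hrb hqd (hsucc m) (hΛge m) hslope' hbase'
  have eQR : ∀ m, Q₁ m + R m = Q₂ m := fun m => Nat.add_sub_cancel' (hQ12 m).le
  have hRpos : ∀ m, 0 < R m := fun m => Nat.sub_pos_of_lt (hQ12 m)
  have hfeed : ∀ m, u' * Λb (m + 1) ≤ v' * (Q₁ m + 1) := fun m => thin_feed u' hv' _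
  have hcd0 : 0 < cd := lt_of_le_of_lt (Nat.zero_le _) hcd
  have hqdr : (0 : ℝ) < qd := by exact_mod_cast hqd
  have hΛ0r : (0 : ℝ) < (Λ0 : ℝ) - 1 := by
    have : (2 : ℝ) ≤ Λ0 := by exact_mod_cast hΛ0
    linarith
  have hcdr : (0 : ℝ) < (cd : ℝ) - cn := by
    have : (cn : ℝ) < cd := by exact_mod_cast hcd
    linarith
  -- the trace ratio of every block
  have hT : ∀ m, (Real.sqrt ((2 * Q₁ m + R m : ℕ) * R m) / R m * 1) ^ 2 / 2 +
      (Real.sqrt ((2 * Q₁ m + R m : ℕ) * R m) / R m * 1) ^ 2 / 2 ≤ ((cd : ℝ) + cn) / ((cd : ℝ) - cn) := fun m => by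
    rw [boxTrace_halves_eq (Q₁ m) (hRpos m)]
    have e1 : 2 * Q₁ m + R m = Q₁ m + Q₂ m := by rw [two_mul, add_assoc, eQR]
    have e2 : ((R m : ℕ) : ℝ) = ((Q₂ m : ℕ) : ℝ) - ((Q₁ m : ℕ) : ℝ) := by
      rw [← eQR m, Nat.cast_add]; ring
    rw [e1, Nat.cast_add, e2]
    exact thin_r_le hv' hcd0 hcd (hQ12 m) (hfrac m)
  have hT0 : ∀ m, 0 ≤ (Real.sqrt ((2 * Q₁ m + R m : ℕ) * R m) / R m * 1) ^ 2 / 2 +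
      (Real.sqrt ((2 * Q₁ m + R m : ℕ) * R m) / R m * 1) ^ 2 / 2 := fun m => by positivity
  have hΛ'0 : ∀ m, (0 : ℝ) ≤ ((Λb (m + 1) * G : ℕ) : ℝ) := fun m => by positivity
  have hΛ' : ∀ m, ((Λb (m + 1) * G : ℕ) : ℝ) ≤ (Λ0 : ℝ) * G * ρ ^ (m + 1) := fun m => geom_top_le hrb G Λ0 m
  have hQ0' : ∀ m, (0 : ℝ) ≤ ((Q₁ m + R m : ℕ) : ℝ) := fun m => by positivity
  set q₀ : ℝ := (qn : ℝ) * Λ0 / qd with hq₀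
  have hq₀0 : 0 ≤ q₀ := by positivity
  have hQle : ∀ m, ((Q₁ m + R m : ℕ) : ℝ) ≤ q₀ * ρ ^ m := fun m => by
    rw [eQR]; exact geom_Q₂_le hrb qn qd Λ0 m
  -- the strip margin
  obtain ⟨L1, hL1⟩ : ∃ L1, Λ0 = L1 + 1 := ⟨Λ0 - 1, by omega⟩
  have hL1' : Λ0 - 1 = L1 := by omega
  have hqG : qn ≤ G * qd := by
    have h1 : qn * (Λ0 - 1) < G * qd * (Λ0 - 1) := lt_of_le_of_lt (Nat.le_add_left _ _) hK
    exact (Nat.lt_of_mul_lt_mul_right h1).le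
  have hK0 : K * qd + qn * Λ0 < G * qd * Λ0 := by
    have h2 : qn * Λ0 = qn * (Λ0 - 1) + qn := by rw [hL1', hL1]; ring
    have h3 : G * qd * Λ0 = G * qd * (Λ0 - 1) + G * qd := by rw [hL1', hL1]; ring
    rw [h2, h3]; omega
  have hKr : (K : ℝ) * qd + qn * ((Λ0 : ℝ) - 1) < G * qd * ((Λ0 : ℝ) - 1) := by
    have h1 : ((K * qd + qn * (Λ0 - 1) : ℕ) : ℝ) < ((G * qd * (Λ0 - 1) : ℕ) : ℝ) := by exact_mod_cast hK
    have e : ((Λ0 - 1 : ℕ) : ℝ) = (Λ0 : ℝ) - 1 := by rw [Nat.cast_sub (by omega)]; simp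
    push_cast [e] at h1
    linarith
  have hc3 : (0 : ℝ) < ((G : ℝ) * qd - qn) * ((Λ0 : ℝ) - 1) - K * qd := by linarith
  set S₀ : ℝ := (G : ℝ) * ((Λ0 : ℝ) - 1) - K with hS₀
  set D₀ : ℝ := (((G : ℝ) * qd - qn) * ((Λ0 : ℝ) - 1) - K * qd) / qd with hD₀
  have hS₀pos : 0 < S₀ := by
    have hqn0 : (0 : ℝ) ≤ (qn : ℝ) * ((Λ0 : ℝ) - 1) := by positivity
    have h1 : 0 < ((G : ℝ) * ((Λ0 : ℝ) - 1) - K) * qd := by nlinarith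
    exact (mul_pos_iff_of_pos_right hqdr).mp h1
  have hD₀pos : 0 < D₀ := by positivity
  have hΛQ : ∀ m, K + (Q₁ m + R m) < Λb m * G := fun m => by
    rw [eQR]; exact canon_strip_shift hK0 (hΛge m)
  have hDge : ∀ m, D₀ * ρ ^ m ≤ ((Λb m * G : ℕ) : ℝ) - ((K + (Q₁ m + R m) : ℕ) : ℝ) := fun m => by
    rw [eQR]; exact geom_strip_den_ge hrb hrab.le hqd hqG m
  have hS : ∀ m, S₀ * ρ ^ m ≤ ((Λb m * G : ℕ) : ℝ) - ((K + (Q₁ m + R m) : ℕ) : ℝ) + ((Q₁ m + R m : ℕ) : ℝ) := fun m => by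
    rw [eQR]; exact geom_strip_span_ge hrb hrab.le m
  have eϑ : q₀ / D₀ = (qn : ℝ) * Λ0 / ((((G : ℝ) * qd - qn) * ((Λ0 : ℝ) - 1) - K * qd)) := by
    rw [hq₀, hD₀]
    field_simp
  -- the four scalar bounds in closed form
  have hA := ctTraceGeom_sum_le (D := fun m => ((Λb m * G : ℕ) : ℝ) - ((K + (Q₁ m + R m) : ℕ) : ℝ))
    (Q := fun m => ((Q₁ m + R m : ℕ) : ℝ)) (T := fun m => (Real.sqrt ((2 * Q₁ m + R m : ℕ) * R m) / R m * 1) ^ 2 / 2 +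
      (Real.sqrt ((2 * Q₁ m + R m : ℕ) * R m) / R m * 1) ^ 2 / 2) (N := (P.N j : ℝ)) (S₀ := S₀)
    (rs := ((cd : ℝ) + cn) / ((cd : ℝ) - cn)) hN hS₀pos hρ1 hS hT0 hT Mb
  have hβ := fun m (_ : m ∈ Finset.range Mb) => ctResidueGeom_le (D := ((Λb m * G : ℕ) : ℝ) - ((K + (Q₁ m + R m) : ℕ) : ℝ))
    (Q := ((Q₁ m + R m : ℕ) : ℝ)) (N := (P.N j : ℝ)) (D₀ := D₀) (S₀ := S₀) (q₀ := q₀) hN hD₀pos hS₀pos hq₀0 hρ1.le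
    (hDge m) (hS m) (hQ0' m) (hQle m)
  rw [eϑ] at hβ
  have hρ := fun m (hm : m ∈ Finset.range Mb) => ctRoundGeom_le (Λ' := ((Λb (m + 1) * G : ℕ) : ℝ)) (N := (P.N j : ℝ))
    (ℓ₀ := (Λ0 : ℝ) * G) (ε := ε) hN hε0 (by positivity) hρ1.le (hΛ'0 m) (hΛ' m) (Finset.mem_range.mp hm)
  have hZ := ctZone_sum_le (T := fun m => (Real.sqrt ((2 * Q₁ m + R m : ℕ) * R m) / R m * 1) ^ 2 / 2 +
      (Real.sqrt ((2 * Q₁ m + R m : ℕ) * R m) / R m * 1) ^ 2 / 2) (M := M) (δ := P.δ j) (rs := ((cd : ℝ) + cn) / ((cd : ℝ) - cn))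
    (by linarith) hδ.le hT Mb
  beta_reduce at hA hZ
  -- the multi-block step
  have hstep := tsum_lowFibre_hstep_blocks_ctE_le P hγ hδ₀ hd hN₀ hρN a b has h0 hb hab j K Λb hΛmono hΛb0 Mb
    Q₁ R hRpos hΛQ hM hMδ hε (u' := u') (v' := v') hfeed (by positivity) (by positivity) hA hβ hρ hZ
  rw [e0] at hstep
  exact hstep

end Cascade

end Summit.AnomalousDissipation.AnomalousDissipation.Theorems.SawtoothPulseCascade.K1Window
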